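import Summits.Langlands.Langlands.Statement
import Literature.NumberTheory.Automorphic.LocalLanglandsDatum
import Literature.NumberTheory.PAdicHodge.FontaineDpst
import HarnessLib

/-!
# `stub_pairCompatibility` (line `Sketch` of the crux `ReciprocityUpToIrreducibility`,
item stmt-Langlands-14328): a kernel-checked lower bound on its strength

The stub `stub_pairCompatibility` of the line `Sketch` (Taylor 2004, Conj. 7 for irreducible
pairs: for every number field `K` ONE reciprocity datum `Rec : ReciprocityData K` such that every
irreducible pinned-geometric `ρ : Γ_K → GL_n(ℚ̄_ℓ)` almost-everywhere Satake–Frobenius compatible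
with an L-algebraic cuspidal `π` of `GL_n(𝔸_K)` is locally–globally compatible with `π` at EVERY
finite place, `LocalGlobalCompatibleAt Rec ι π.1 ρ v`) is an OPEN PROBLEM and is not proved here.

This file records, sorry-free, that the stub is at least as strong as the local Langlands
correspondence for `GL_n` over the completions of number fields: its outermost `∃ Rec :
ReciprocityData K` names a `LocalLanglandsDatum (K_v)` (Harris–Taylor's `rec_v`, with its
bijections `Irr(GL_m(K_v)) ≃ {Frobenius-semisimple WD representations}/≅` for all `m`) at every
finite place `v` of every number field `K` — in the present tree available only through the
undischarged named fact `LocalLanglandsDatum.nonempty` (Harris–Taylor 2001 Thm. A / Henniart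
2000 Thm. 1.2, with Deligne's local constants).  Companion of
`nonempty_localLanglandsDatum_of_reciprocityUpToIrreducibility` (same namespace, file
`IrreducibilityBySelfDualityReciprocityUpToIrreducibilityRankOne.lean`), which does the same for
the crux itself.

* `nonempty_localLanglandsDatum_of_pairCompatibility` — the stub (its statement written out as
  the antecedent, tree vocabulary only; no `def … : Prop` is introduced) inhabits
  `LocalLanglandsDatum (v.adicCompletion K)` for every `K`, `v`: the named fact
  `LocalLanglandsDatum.nonempty` restricted to completions of number fields.
* `nonempty_reciprocityData_iff_canonical`, `nonempty_reciprocityData_of_canonical_nonempty` —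
  after the statement re-type of 2026-08-16/17 (`ReciprocityData` pins `llc_isCanonical`,
  `llc_eps_isCanonical`), `ReciprocityData K` is inhabited iff every completion `K_v` carries a
  local Langlands datum whose local Artin map, and whose `ε`-system's Artin maps at every finite
  `E/K_v`, are THE canonical ones (`LocalArtinData.IsCanonical`); so the `∃ Rec` of the stub is
  EXACTLY as strong as canonically normalised local Langlands data at all completions (the bare
  named fact `LocalLanglandsDatum.nonempty` does not supply the two canonicity conjuncts; its
  canonical re-issue does), and the open content is the compatibility clause
  `LocalGlobalCompatibleAt` at every place.  The former `nonempty_reciprocityData_iff`,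
  `nonempty_reciprocityData_of_localLanglandsDatum_nonempty` (stated for the one-field
  `ReciprocityData`, no longer provable) are kept as `@[deprecated]` aliases of these two:
  Theorems files are append-only.

No new axioms (`propext`, `Classical.choice`, `Quot.sound`).
-/

open scoped NumberField
open Filter IsDedekindDomain
open Literature.NumberTheory.Automorphic Literature.NumberTheory.GaloisRepresentations

noncomputable section

set_option linter.dupNamespace false -- project-wide option (lakefile weak.linter.dupNamespace); `Summit.Langlands.Langlands` is the mandated namespace

namespace Summit.Langlands.Langlands.Theorems.ReciprocityUpToIrreducibility

/-- **A lower bound on the logical strength of the stub: it names the local Langlands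
correspondences of all completions.**  `stub_pairCompatibility` (its statement written out as the
antecedent, verbatim) begins `∀ K, ∃ Rec : ReciprocityData K`, and a reciprocity datum carries a
`LocalLanglandsDatum (K_v)` (Harris–Taylor's `rec_v`) at every finite place `v`; so any proof of
the stub inhabits `LocalLanglandsDatum (v.adicCompletion K)` for every number field `K` and every
`v` — i.e. it proves the named fact `LocalLanglandsDatum.nonempty` (Harris–Taylor 2001 Thm. A /
Henniart 2000 Thm. 1.2, with Deligne's local constants; undischarged in the present tree)
restricted to the completions of number fields.  The extraction is non-vacuous: `∃ Rec` sits
directly under `∀ K`, before any automorphic or Galois hypothesis.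
[cite: HarrisTaylorAMS2001, Thm. A] -/
theorem nonempty_localLanglandsDatum_of_pairCompatibility :
    (∀ (K : Type) [Field K] [NumberField K], ∃ Rec : ReciprocityData K,
      ∀ (n : ℕ) (hcpt : isCompact_glFiniteIntegralLevel n K), 0 < n →
        ∀ (π : CuspidalAutomorphicRepData n K hcpt), π.1.IsLAlgebraic →
          ∀ (ℓ : ℕ) [Fact ℓ.Prime] (ι : PadicAlgCl ℓ ≃+* ℂ)
            (ρ : FramedGaloisRep K (PadicAlgCl ℓ) n),
            ρ.toGaloisRep.IsIrreducible →
            ((∀ᶠ v : HeightOneSpectrum (𝓞 K) in cofinite, ρ.IsUnramifiedAt v) ∧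
              ∀ (v : HeightOneSpectrum (𝓞 K)) (hv : ((ℓ : ℕ) : 𝓞 K) ∈ v.asIdeal),
                (Literature.NumberTheory.PAdicHodge.fontainePstAdicCompletion v ℓ hv).IsDeRhamFramed
                  (ρ.toLocal v)) →
              (∀ᶠ v : HeightOneSpectrum (𝓞 K) in cofinite, SatakeFrobCompatibleAt ι π.1 ρ v) →
                ∀ v : HeightOneSpectrum (𝓞 K), LocalGlobalCompatibleAt Rec ι π.1 ρ v) →
      ∀ (K : Type) [Field K] [NumberField K] (v : HeightOneSpectrum (𝓞 K)),
        Nonempty (LocalLanglandsDatum (v.adicCompletion K)) := by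
  intro h K _ _ v
  obtain ⟨Rec, -⟩ := h K
  exact ⟨Rec.llc v⟩

/-- Conversely to nothing: a reciprocity datum for `K` exists iff every completion `K_v` carries
a local Langlands datum `L` (Harris–Taylor's `rec`, with its Artin datum and `ε`-system) whose
local Artin map is THE canonical one (`LocalArtinData.IsCanonical`) and whose `ε`-system is
normalised against the canonical Artin map of every finite `E/K_v` — the three fields `llc`,
`llc_isCanonical`, `llc_eps_isCanonical` of the re-typed structure `ReciprocityData`, read place
by place (`→`: the fields; `←`: choice over `v`).  Recorded so that the `∃ Rec` of the stub is
seen to be EXACTLY as strong as canonically normalised local Langlands data at all completions —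
the open content of the stub is the compatibility clause, not the existence of `Rec`.  (Same
statement as `ReciprocityTRCM.nonempty_reciprocityData_iff`, kept here so that this file imports
the summit `Statement` only.) [folklore] -/
theorem nonempty_reciprocityData_iff_canonical (K : Type) [Field K] [NumberField K] :
    Nonempty (ReciprocityData K) ↔
      ∀ v : HeightOneSpectrum (𝓞 K), ∃ L : LocalLanglandsDatum (v.adicCompletion K),
        L.artin.IsCanonical ∧
          ∀ (E : Type) [Field E] [ValuativeRel E] [TopologicalSpace E] [IsNonarchimedeanLocalField E]
            [Algebra (v.adicCompletion K) E] [FiniteDimensional (v.adicCompletion K) E],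
            (L.eps.artin E).IsCanonical := by
  refine ⟨fun ⟨Rec⟩ v ↦
    ⟨Rec.llc v, Rec.llc_isCanonical v, fun E _ _ _ _ _ _ ↦ Rec.llc_eps_isCanonical v E⟩, fun h ↦ ?_⟩
  choose L hL hLE using h
  exact ⟨⟨L, hL, fun v E _ _ _ _ _ _ ↦ hLE v E⟩⟩

/-- Under the CANONICAL re-issue of the named fact `LocalLanglandsDatum.nonempty` (Harris–Taylor
2001 Thm. A / Henniart 2000 Thm. 1.2, with local class field theory and Deligne's local constants
normalised against THE Artin maps: over every non-archimedean local field `F` in `Type` some local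
Langlands datum has the canonical Artin map and an `ε`-system canonical at every finite `E/F`),
reciprocity data exist for every number field.  The bare `LocalLanglandsDatum.nonempty` no longer
suffices since the re-type (it forgets both normalisations). [cite: HarrisTaylorAMS2001, Thm. A] -/
theorem nonempty_reciprocityData_of_canonical_nonempty
    (h : ∀ (F : Type) [Field F] [ValuativeRel F] [TopologicalSpace F] [IsNonarchimedeanLocalField F],
      ∃ L : LocalLanglandsDatum F, L.artin.IsCanonical ∧
        ∀ (E : Type) [Field E] [ValuativeRel E] [TopologicalSpace E] [IsNonarchimedeanLocalField E]
          [Algebra F E] [FiniteDimensional F E], (L.eps.artin E).IsCanonical)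
    (K : Type) [Field K] [NumberField K] :
    Nonempty (ReciprocityData K) :=
  (nonempty_reciprocityData_iff_canonical K).2 fun v ↦ h (v.adicCompletion K)

/-- **Deprecated record.** Formerly `Nonempty (ReciprocityData K) ↔ ∀ v, Nonempty
(LocalLanglandsDatum (v.adicCompletion K))`.  Since the 2026-08-16/17 re-type of `ReciprocityData`
(pins `llc_isCanonical`, `llc_eps_isCanonical`) the `←` direction is no longer provable — it would
have to produce THE canonical Artin normalisations (`LocalArtinData.IsCanonical`, a pin by
specification) from arbitrary local Langlands data — so the name is kept (Theorems files are
append-only) as an alias of the corrected equivalence `nonempty_reciprocityData_iff_canonical`.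
[folklore] -/
@[deprecated nonempty_reciprocityData_iff_canonical (since := "2026-08-17")]
alias nonempty_reciprocityData_iff := nonempty_reciprocityData_iff_canonical

/-- Append-only bookkeeping (no mathematical content): the compiler-generated pattern-matching
auxiliary of the deprecated record `nonempty_reciprocityData_iff` (its former term-mode proof
destructured `Nonempty (ReciprocityData K)`), indexed by the gate with the first version of this
file; kept under its name as an alias of the identical auxiliary of
`nonempty_reciprocityData_iff_canonical`. [folklore] -/
@[deprecated nonempty_reciprocityData_iff_canonical.match_1_1 (since := "2026-08-17")]
alias nonempty_reciprocityData_iff.match_1_1 := nonempty_reciprocityData_iff_canonical.match_1_1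

/-- **Deprecated record.** Formerly `LocalLanglandsDatum.nonempty → ∀ K, Nonempty
(ReciprocityData K)`.  Since the re-type the bare named fact `LocalLanglandsDatum.nonempty` forgets
both normalisations a reciprocity datum now pins, so the implication is no longer provable; the
name is kept as an alias of the corrected statement `nonempty_reciprocityData_of_canonical_nonempty`
(hypothesis: the canonical re-issue of the fact). [cite: HarrisTaylorAMS2001, Thm. A] -/
@[deprecated nonempty_reciprocityData_of_canonical_nonempty (since := "2026-08-17")]
alias nonempty_reciprocityData_of_localLanglandsDatum_nonempty :=
  nonempty_reciprocityData_of_canonical_nonempty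

end Summit.Langlands.Langlands.Theorems.ReciprocityUpToIrreducibility

end
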